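import Literature.Analysis.FluidPDE.OnsagerBDSVPerturbation
import Literature.Analysis.FluidPDE.OnsagerBDSVSquigglingCutoffs
import Literature.Analysis.FluidPDE.OnsagerBDSVPerturbationProofs
import Literature.Analysis.FluidPDE.OnsagerBDSVPerturbationER
import Literature.Analysis.FluidPDE.OnsagerBDSVMikadoProofs
import HarnessLib

/-!
# Onsager's conjecture (Buckmaster–De Lellis–Székelyhidi–Vicol): the perturbation stage, assembly

T. Buckmaster, C. De Lellis, L. Székelyhidi Jr., V. Vicol, *Onsager's conjecture for admissible
weak solutions*, Comm. Pure Appl. Math. **72** (2019) = arXiv:1701.08678, §§5–6. The named fact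
`BDSV.perturbationStage` (`OnsagerBDSVThreeStages.lean`) was reduced in
`OnsagerBDSVPerturbation.lean` (`BDSV.perturbationStage_of_parts`) to seven parts: Mikado flows
(Lemma 5.1, `BDSV.mikado_exists`), squiggling cut-offs (Lemma 5.3, `BDSV.cutoffs_exist`),
backward flows (§5.2 / App. B, `BDSV.backwardFlow_exists`), the increment bound (Cor. 5.8,
`BDSV.incrementEstimate`), the Euler–Reynolds identity for the new triple (§5.4,
`BDSV.newTriple_isEulerReynolds`), the stress estimate (Prop. 6.1, `BDSV.stressEstimate`) and the
energy estimate (Prop. 6.2, `BDSV.energyEstimate`).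

Three of the parts are discharged in the tree (`BDSV.cutoffs_exist_holds`,
`OnsagerBDSVSquigglingCutoffs.lean`; `BDSV.backwardFlow_exists_holds`,
`OnsagerBDSVPerturbationProofs.lean`; `BDSV.newTriple_isEulerReynolds_holds`,
`OnsagerBDSVPerturbationER.lean`). This file feeds them in: `BDSV.perturbationStage` follows from
the four remaining named facts (`BDSV.perturbationStage_of_remaining`); with the Mikado flows of
Lemma 5.1 also discharged (`BDSV.mikado_exists_holds`, `OnsagerBDSVMikadoProofs.lean`), it follows
from the three estimates alone (`BDSV.perturbationStage_of_three`: Cor. 5.8, Prop. 6.1, Prop. 6.2).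
The discharge `perturbationStage_holds` is to be appended here once `incrementEstimate`,
`stressEstimate`, `energyEstimate` are discharged:
`perturbationStage_of_three incrementEstimate_holds stressEstimate_holds energyEstimate_holds`.
-/

namespace Literature.Analysis.FluidPDE

namespace BDSV

/-- **The perturbation stage from its four remaining parts** (BDSV §§5–6): given the Mikado
datum of Lemma 5.1, the increment bound of Cor. 5.8 and the estimates of Props. 6.1–6.2 (as the
named facts `BDSV.mikado_exists`, `BDSV.incrementEstimate`, `BDSV.stressEstimate`,
`BDSV.energyEstimate`), the perturbation stage `BDSV.perturbationStage` holds — the squiggling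
cut-offs (Lemma 5.3), the backward flows (§5.2) and the Euler–Reynolds identity of the new
triple (§5.4) being proved in the tree. [cite: BuckmasterEtAl2018, §§5–6 (Lemma 5.1, Lemma 5.3,
§5.2, Cor. 5.8, §5.4, Prop. 6.1, Prop. 6.2)] -/
theorem perturbationStage_of_remaining (h₁ : mikado_exists) (h₄ : incrementEstimate)
    (h₆ : stressEstimate) (h₇ : energyEstimate) : perturbationStage :=
  perturbationStage_of_parts h₁ cutoffs_exist_holds backwardFlow_exists_holds h₄
    newTriple_isEulerReynolds_holds h₆ h₇

/-- **The perturbation stage from its three estimates** (BDSV §2.6: the new triple satisfies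
"(2.23)–(2.24c), cf. Corollary 5.8 and Propositions 6.1 and 6.2"): given the increment bound of
Cor. 5.8 and the estimates of Props. 6.1–6.2 (the named facts `BDSV.incrementEstimate`,
`BDSV.stressEstimate`, `BDSV.energyEstimate`), the perturbation stage `BDSV.perturbationStage`
holds — the Mikado flows (Lemma 5.1), the squiggling cut-offs (Lemma 5.3), the backward flows
(§5.2) and the Euler–Reynolds identity of the new triple (§5.4) being proved in the tree.
[cite: BuckmasterEtAl2018, §2.6 (2.23)–(2.24c) (Cor. 5.8, Prop. 6.1, Prop. 6.2)] -/
theorem perturbationStage_of_three (h₄ : incrementEstimate) (h₆ : stressEstimate)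
    (h₇ : energyEstimate) : perturbationStage :=
  perturbationStage_of_remaining mikado_exists_holds h₄ h₆ h₇

end BDSV

end Literature.Analysis.FluidPDE
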